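/-
Copyright (c) 2026. All rights reserved.
Released under Apache 2.0 license as described in the file LICENSE.
Authors: abc-iut cell, prover seat abc-iut-w5-d053 (gen 5; rows «SB′-BRICK-B-TS» / brick E input of abc-iut-w5-d144's COR510iv-SB′
closer spec), over abc-iut-w6-d028's setting `nonarchGenuineOver p ι` and its holomorphic-side theorems, this seat's open-augmentation
sub-model `nonarchGenuineMonoAnSub p P ψ`, abc-iut-f-101's `genuineOpen` and `cor55Observables_of_iotaSquaresCommute`.
-/
import Literature.AnabelianGeometry.AbsoluteAnabelian.LogFrobeniusNonarchGenuineOver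
import Literature.AnabelianGeometry.AbsoluteAnabelian.LogFrobeniusMonoGenuineIotaOverTS
import HarnessLib

/-!
# [AbsTopIII] The holomorphic column of the genuine OPEN-AUGMENTATION carrier IS the column «over ι» (ι := the inclusion
# `𝒳^{open} ↪ 𝒳`): Cor 5.5 (i), (ii), (iii)⊞, (v), the `ι⊞`-squares, the log-wall / (iv) — transported on the nose

S. Mochizuki, *Topics in absolute anabelian geometry III*, J. Math. Sci. Univ. Tokyo 22 (2015) [MochizukiAbsTopIII2015]; locators =
kurims manuscript pages (`paper:url-5493eb38cbb7`): Def 5.4 (iii) p. 126 (the diagram `Γ⃗^log_non`, its commuting square), (iv)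
p. 127, (vii) p. 128; Cor 5.5 (i)–(v) pp. 130–131; Cor 5.10 (iv) p. 147.

## What this file proves (PROOF-ONLY; no def, no Prop fact)

A DEFINITIONAL OBSERVATION with consequences.  This seat's sub-model settings `nonarchGenuineMonoAnSub p P ψ Vmod isArc`
(`AbsTopIII/MLFGaloisModelOpenAug.lean`; the genuine open-augmentation carrier `genuineOpen p Vmod` of abc-iut-f-101's
`cor510MonoTelecorePinned_genuineOpen` is the case `P = IsOpenAug`, `ψ = ψMonoPf`, all places nonarchimedean) have — field by
field, by `rfl` — the SAME HOLOMORPHIC ROWS (`𝒳`, `ℰ•`, `𝒩⊞_v`, `𝒩_v`, `log`, `λ⊞`, `ι⊞`, `λ⊞ lies over`, `An•`, `κ_{An}`) as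
abc-iut-w6-d028's setting OVER A FUNCTOR `nonarchGenuineOver p ι Vmod isArc` (`LogFrobeniusNonarchGenuineOver.lean`) at
`C := P.FullSubcategory`, `ι := P.ι` (§1: `nonarchLamSub_eq_overLam`, `nonarchGenuineMonoAnSub_holomorphic_eq`); likewise the
`TS` data (`nonarchGenuineMonoAnSubTS` of `LogFrobeniusMonoGenuineIotaOverTS.lean` vs `nonarchGenuineOverTS p P.ι`).  The two
settings differ ONLY on the mono-analytic side (`Up 𝒯𝔾` there, abc-iut-w6-d036's `Up MonoBase` with genuine containers here).
Hence assertions of the §5 interface that read only holomorphic rows (+ the `TS` datum) TRANSPORT by `exact` from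
abc-iut-w6-d028's over-`ι` theorems whenever the kernel's unifier unfolds both sides to the same term (§2; it does for the
`ι⊞`-squares and for the `TS` two-path lemma, the two places where the model's ARITHMETIC enters), the rest being the same
one-line generic proofs as over `ι`:

* ★ `nonarchGenuineMonoAnSub_iotaSquaresCommute` — abc-iut-f-101's `IotaSquaresCommute v` (the `ι⊞`-squares of Def 5.4 (iii)
  commute) at EVERY sub-model carrier and place (transported); ⇒ ★ `nonarchGenuineMonoAnSub_cor55Observables` — FACT-LIST F-3081
  `Cor55Observables` (Cor 5.5 (iii), `⊞`-half) HOLDS there (abc-iut-f-101's `cor55Observables_of_iotaSquaresCommute`);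
* `nonarchGenuineMonoAnSub_cor55Cores_and_telecore` (Cor 5.5 (i), (ii): abc-iut-L4-t3's universal theorems),
  `nonarchGenuineMonoAnSub_cor55LogWall_and_notSimCompat` (the log-wall and Cor 5.5 (iv) for the carrier's OWN `TS` datum at any
  nonarchimedean place: abc-iut-L4-t5's origin theorem fed with abc-iut-w6-d028's `overIotaTS_twoPath` at `ι := P.ι`, transported),
  `nonarchGenuineMonoAnSub_cor55CoreRigid_iff` (Cor 5.5 (v)'s `□`-rigidity ↔ `IsIdRigid P.FullSubcategory`),
  `nonarchGenuineMonoAnSub_cor55Rigidity_iff`;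
* the `genuineOpen p Vmod` specialisations ★ `genuineOpen_iotaSquaresCommute` (= hypothesis `hsq` of brick E of the SB′ closer),
  ★ `genuineOpen_cor55Observables`, `genuineOpen_cor55Cores_and_telecore`, `genuineOpen_cor55LogWall_and_notSimCompat` (every place,
  every object), `genuineOpen_cor55CoreRigid_iff`.

METHOD NOTE for the seats of the SB′ closer and of «COR55iii-TS-OBSERVABLE-GENERIC» (abc-iut-L4-t5): prove holomorphic-side
model instances at the generality `nonarchGenuineOver p ι` — they then hold at `nonarchGenuineSlim`, at every
`nonarchGenuineMonoAnSub p P ψ` and at `genuineOpen` by `exact`, as here.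

HONEST FRAMING: MODEL-LEVEL; definitional transport, no new mathematics beyond abc-iut-w6-d028's over-`ι` theorems; refereed
pre-IUT material; nothing here bears on [IUTchIII] Cor. 3.12; no side taken; typed ≠ proved; instantiated ≠ endorsed.
-/

set_option autoImplicit false

open CategoryTheory

namespace Literature.AnabelianGeometry.AbsoluteAnabelian

namespace LogFrobeniusSetting

open AbsTopIII

variable (p : ℕ) [Fact p.Prime] (P : ObjectProperty (TFModel p))
  (ψ : (b : Bool) → LogVertex b → (MLFClosure.AnMono ⥤ MLFClosure.MonoBase × TSObj)) (Vmod : Type 1) (isArc : Vmod → Bool)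

/-! ## §1. The holomorphic rows of the sub-model ARE the rows over `P.ι` -/

/-- `λ⊞_{v,ν}` of the sub-model is abc-iut-w6-d028's `overLam` at `ι := P.ι`. [cite: MochizukiAbsTopIII2015, Definition 5.4 (iv) p.127] -/
theorem nonarchLamSub_eq_overLam (b : Bool) (ν : LogVertex b) : nonarchLamSub p P b ν = overLam p P.ι b ν := by
  cases b <;> rfl

/-- `ι_{v,ε}` (before the twist) of the sub-model is `overIotaCore` at `ι := P.ι`.
[cite: MochizukiAbsTopIII2015, Definition 5.4 (vii) p.128] -/
theorem nonarchIotaCoreSub_heq_overIotaCore (b : Bool) {ν₁ ν₂ : LogVertex b} (ε : LogEdgeTS b ν₁ ν₂) :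
    HEq (nonarchIotaCoreSub p P b ε) (overIotaCore p P.ι b ε) := by
  cases b <;> rfl

/-- **The holomorphic rows of `nonarchGenuineMonoAnSub p P ψ` are those of `nonarchGenuineOver p P.ι`** (same `𝒳`, `ℰ•`, `𝒩⊞_v`,
`𝒩_v`, `log`, `An•`; `λ⊞`, `ι⊞` up to the per-Boolean identification). [cite: MochizukiAbsTopIII2015, Definition 5.4 (iv) p.127] -/
theorem nonarchGenuineMonoAnSub_holomorphic_eq :
    (nonarchGenuineMonoAnSub p P ψ Vmod isArc).X = (nonarchGenuineOver p P.ι Vmod isArc).X ∧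
      (nonarchGenuineMonoAnSub p P ψ Vmod isArc).E = (nonarchGenuineOver p P.ι Vmod isArc).E ∧
      (nonarchGenuineMonoAnSub p P ψ Vmod isArc).Nplus = (nonarchGenuineOver p P.ι Vmod isArc).Nplus ∧
      (nonarchGenuineMonoAnSub p P ψ Vmod isArc).N = (nonarchGenuineOver p P.ι Vmod isArc).N ∧
      (nonarchGenuineMonoAnSub p P ψ Vmod isArc).An = (nonarchGenuineOver p P.ι Vmod isArc).An ∧
      HEq (nonarchGenuineMonoAnSub p P ψ Vmod isArc).log (nonarchGenuineOver p P.ι Vmod isArc).log ∧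
      HEq (nonarchGenuineMonoAnSub p P ψ Vmod isArc).lam (nonarchGenuineOver p P.ι Vmod isArc).lam := by
  refine ⟨rfl, rfl, rfl, rfl, rfl, HEq.rfl, ?_⟩
  have h : (nonarchGenuineMonoAnSub p P ψ Vmod isArc).lam = (nonarchGenuineOver p P.ι Vmod isArc).lam := by
    funext v
    exact funext fun ν => nonarchLamSub_eq_overLam p P (isArc v) ν
  exact heq_of_eq h

/-! ## §2. Transport of the holomorphic-side theorems over `ι := P.ι` -/

/-- ★ **The `ι⊞`-squares commute at every sub-model carrier and every place** (abc-iut-f-101's `IotaSquaresCommute`; transported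
from abc-iut-w6-d028's `nonarchGenuineOver_iotaSquaresCommute` at `ι := P.ι` — the kernel identifies the two statements).
[cite: MochizukiAbsTopIII2015, Definition 5.4 (iii) p.126] -/
theorem nonarchGenuineMonoAnSub_iotaSquaresCommute (v : Vmod) : (nonarchGenuineMonoAnSub p P ψ Vmod isArc).IotaSquaresCommute v :=
  nonarchGenuineOver_iotaSquaresCommute p P.ι Vmod isArc v

/-- ★ **FACT-LIST F-3081 `Cor55Observables` (Cor 5.5 (iii), `⊞`-half) HOLDS at every sub-model carrier** (abc-iut-f-101's
`cor55Observables_of_iotaSquaresCommute`). [cite: MochizukiAbsTopIII2015, Cor 5.5 (iii) p. 131] -/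
theorem nonarchGenuineMonoAnSub_cor55Observables : (nonarchGenuineMonoAnSub p P ψ Vmod isArc).Cor55Observables :=
  (nonarchGenuineMonoAnSub p P ψ Vmod isArc).cor55Observables_of_iotaSquaresCommute
    (nonarchGenuineMonoAnSub_iotaSquaresCommute p P ψ Vmod isArc)

/-- **Cor 5.5 (i), (ii) at every sub-model carrier** (abc-iut-L4-t3's universal theorems, by name).
[cite: MochizukiAbsTopIII2015, Cor 5.5 (i) p. 130] -/
theorem nonarchGenuineMonoAnSub_cor55Cores_and_telecore [Nonempty Vmod] :
    (nonarchGenuineMonoAnSub p P ψ Vmod isArc).Cor55Cores ∧ (nonarchGenuineMonoAnSub p P ψ Vmod isArc).Cor55Telecore :=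
  ⟨(nonarchGenuineMonoAnSub p P ψ Vmod isArc).cor55Cores_holds, (nonarchGenuineMonoAnSub p P ψ Vmod isArc).cor55Telecore_holds⟩

/-- **The log-wall and Cor 5.5 (iv) at every sub-model carrier for its OWN `TS` datum** `nonarchGenuineMonoAnSubTS`, at any
nonarchimedean place (abc-iut-L4-t5's origin theorem fed with abc-iut-w6-d028's over-`ι` two-path lemma `overIotaTS_twoPath` at
`ι := P.ι` — the `TS` components of `nonarchGenuineMonoAnSubTS` ARE those of `nonarchGenuineOverTS p P.ι`, by `rfl` in the kernel).
[cite: MochizukiAbsTopIII2015, Cor 5.5 (iv) p. 131] -/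
theorem nonarchGenuineMonoAnSub_cor55LogWall_and_notSimCompat (v₀ : Vmod) (hv₀ : isArc v₀ = false)
    (x₀ : Up P.FullSubcategory) :
    (nonarchGenuineMonoAnSub p P ψ Vmod isArc).Cor55LogWall (nonarchGenuineMonoAnSubTS p P ψ Vmod isArc) ∧
      (nonarchGenuineMonoAnSub p P ψ Vmod isArc).Cor55NotSimultaneouslyCompatible (nonarchGenuineMonoAnSubTS p P ψ Vmod isArc) :=
  (nonarchGenuineMonoAnSub p P ψ Vmod isArc).cor55LogWall_and_notSimCompat_of_iota_injective
    (nonarchGenuineMonoAnSubTS p P ψ Vmod isArc) v₀ hv₀ x₀ (overΨ (C := P.FullSubcategory))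
    (fun νu νm νc _ _ _ ε₁ ε₂ ε₃ ε₄ => overIotaTS_twoPath p P.ι (isArc v₀) hv₀ νu νm νc ε₁ ε₂ ε₃ ε₄ x₀)

/-- **Cor 5.5 (v)'s total `□`-rigidity at a sub-model carrier is EXACTLY the id-rigidity of `𝒳^{P}`** (abc-iut-w5-d112's
`cor55CoreRigid_iff` + abc-iut-w4-d020's `isIdRigid_up_iff`, as over `ι`).
[cite: MochizukiAbsTopIII2015, Cor 5.5 (v) p. 131] -/
theorem nonarchGenuineMonoAnSub_cor55CoreRigid_iff :
    (nonarchGenuineMonoAnSub p P ψ Vmod isArc).Cor55CoreRigid ↔ IsIdRigid P.FullSubcategory :=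
  (nonarchGenuineMonoAnSub p P ψ Vmod isArc).cor55CoreRigid_iff.trans (isIdRigid_up_iff P.FullSubcategory)

/-- Cor 5.5 (v) at a sub-model carrier: rigidity ↔ id-rigidity of `𝒳^{P}` ∧ the `ℤ`-action clause.
[cite: MochizukiAbsTopIII2015, Cor 5.5 (v) p. 131] -/
theorem nonarchGenuineMonoAnSub_cor55Rigidity_iff :
    (nonarchGenuineMonoAnSub p P ψ Vmod isArc).Cor55Rigidity ↔
      IsIdRigid P.FullSubcategory ∧ (nonarchGenuineMonoAnSub p P ψ Vmod isArc).Cor55ShiftAction :=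
  and_congr_left' (nonarchGenuineMonoAnSub_cor55CoreRigid_iff p P ψ Vmod isArc)

/-! ## §3. At abc-iut-f-101's `genuineOpen p Vmod` -/

/-- ★ **The `ι⊞`-squares commute at the genuine open-augmentation carrier** (hypothesis `hsq` of brick E of the SB′ closer).
[cite: MochizukiAbsTopIII2015, Definition 5.4 (iii) p.126] -/
theorem genuineOpen_iotaSquaresCommute (v : Vmod) : (genuineOpen p Vmod).IotaSquaresCommute v :=
  nonarchGenuineMonoAnSub_iotaSquaresCommute p (TFModel.IsOpenAug (p := p)) MLFClosure.ψMonoPf Vmod (fun _ => false) v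

/-- ★ **F-3081 `Cor55Observables` HOLDS at the genuine open-augmentation carrier.** [cite: MochizukiAbsTopIII2015, Cor 5.5 (iii) p. 131] -/
theorem genuineOpen_cor55Observables : (genuineOpen p Vmod).Cor55Observables :=
  nonarchGenuineMonoAnSub_cor55Observables p (TFModel.IsOpenAug (p := p)) MLFClosure.ψMonoPf Vmod (fun _ => false)

/-- Cor 5.5 (i), (ii) at the genuine open-augmentation carrier. [cite: MochizukiAbsTopIII2015, Cor 5.5 (i) p. 130] -/
theorem genuineOpen_cor55Cores_and_telecore [Nonempty Vmod] :
    (genuineOpen p Vmod).Cor55Cores ∧ (genuineOpen p Vmod).Cor55Telecore :=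
  nonarchGenuineMonoAnSub_cor55Cores_and_telecore p (TFModel.IsOpenAug (p := p)) MLFClosure.ψMonoPf Vmod (fun _ => false)

/-- The log-wall and Cor 5.5 (iv) at the genuine open-augmentation carrier for its own `TS` datum `genuineOpenTS`, at every
place (all places are nonarchimedean there). [cite: MochizukiAbsTopIII2015, Cor 5.5 (iv) p. 131] -/
theorem genuineOpen_cor55LogWall_and_notSimCompat (v₀ : Vmod) (x₀ : (genuineOpen p Vmod).X) :
    (genuineOpen p Vmod).Cor55LogWall (genuineOpenTS p Vmod) ∧
      (genuineOpen p Vmod).Cor55NotSimultaneouslyCompatible (genuineOpenTS p Vmod) :=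
  nonarchGenuineMonoAnSub_cor55LogWall_and_notSimCompat p (TFModel.IsOpenAug (p := p)) MLFClosure.ψMonoPf Vmod (fun _ => false) v₀ rfl x₀

/-- Cor 5.5 (v)'s `□`-rigidity at the genuine open-augmentation carrier ↔ id-rigidity of `𝒳^{open}`.
[cite: MochizukiAbsTopIII2015, Cor 5.5 (v) p. 131] -/
theorem genuineOpen_cor55CoreRigid_iff :
    (genuineOpen p Vmod).Cor55CoreRigid ↔ IsIdRigid (TFModel.IsOpenAug (p := p)).FullSubcategory :=
  nonarchGenuineMonoAnSub_cor55CoreRigid_iff p (TFModel.IsOpenAug (p := p)) MLFClosure.ψMonoPf Vmod (fun _ => false)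


/-! ## §4. The `TS`-valued `ι`-squares over `ι` and at the sub-model / open carriers (input of the generic nonarchimedean
`S_log` construction, abc-iut-L4-t5's «COR55iii-TS-OBSERVABLE-GENERIC» W2, at these carriers) -/

variable {P ψ Vmod isArc}

section OverTS

variable {C : Type 1} [Category.{1} C] (ι : C ⥤ TFModel p)

/-- **The `TS`-valued `ι`-squares over `ι` commute at a NONARCHIMEDEAN place**: for any two 2-chains `ν₁ → ν₂ → ν₃`,
`ν₁ → ν₂' → ν₃` of edges of the FULL graph `Γ⃗^log_non` (incl. `k̄^× ↪ k̄`) out of a pre-log vertex, the composites of the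
components of abc-iut-w6-d028's `overIotaTS` agree — the only genuine instance is the printed square of Def 5.4 (iii) at `ι(x)`
(`TFModel_iotaSquare_comm`); the new edge `k̄^× ↪ k̄` closes no second square (the `TS` analogue, same shape, of abc-iut-f-101's
`IotaSquaresCommute` / abc-iut-w6-d028's `overIota_squaresCommute`). [cite: MochizukiAbsTopIII2015, Definition 5.4 (iii) p.126] -/
theorem overIotaTS_squaresCommute (b : Bool) (hb : b = false) ⦃ν₁ ν₂ ν₂' ν₃ : LogVertex b⦄
    (h₁ : ν₁.isPostLog = false) (_h₂ : ν₂.isPostLog = false) (_h₂' : ν₂'.isPostLog = false)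
    (_h₃ : ν₃.isPostLog = false) (ε₁₂ : LogEdgeTS b ν₁ ν₂) (ε₂₃ : LogEdgeTS b ν₂ ν₃) (ε₁₂' : LogEdgeTS b ν₁ ν₂')
    (ε₂'₃ : LogEdgeTS b ν₂' ν₃) (X₀ : Up C)
    (m₁₂ : (overLam p ι b ν₁).obj X₀ ⟶ (overLam p ι b ν₂).obj X₀)
    (m₂₃ : (overLam p ι b ν₂).obj X₀ ⟶ (overLam p ι b ν₃).obj X₀)
    (m₁₂' : (overLam p ι b ν₁).obj X₀ ⟶ (overLam p ι b ν₂').obj X₀)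
    (m₂'₃ : (overLam p ι b ν₂').obj X₀ ⟶ (overLam p ι b ν₃).obj X₀)
    (hm₁₂ : HEq m₁₂ ((overIotaTS p ι b ε₁₂).app X₀)) (hm₂₃ : HEq m₂₃ ((overIotaTS p ι b ε₂₃).app X₀))
    (hm₁₂' : HEq m₁₂' ((overIotaTS p ι b ε₁₂').app X₀)) (hm₂'₃ : HEq m₂'₃ ((overIotaTS p ι b ε₂'₃).app X₀)) :
    m₁₂ ≫ m₂₃ = m₁₂' ≫ m₂'₃ := by
  subst hb
  revert hm₁₂ hm₂₃ hm₁₂' hm₂'₃ m₁₂ m₂₃ m₁₂' m₂'₃ h₁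
  change ∀ (h₁ : ν₁.isPostLog = false) (m₁₂ : _) (m₂₃ : _) (m₁₂' : _) (m₂'₃ : _),
    HEq m₁₂ ((overIotaTS p ι false (show NonarchEdge ν₁ ν₂ from ε₁₂)).app X₀) →
    HEq m₂₃ ((overIotaTS p ι false (show NonarchEdge ν₂ ν₃ from ε₂₃)).app X₀) →
    HEq m₁₂' ((overIotaTS p ι false (show NonarchEdge ν₁ ν₂' from ε₁₂')).app X₀) →
    HEq m₂'₃ ((overIotaTS p ι false (show NonarchEdge ν₂' ν₃ from ε₂'₃)).app X₀) → m₁₂ ≫ m₂₃ = m₁₂' ≫ m₂'₃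
  generalize (show NonarchEdge ν₁ ν₂ from ε₁₂) = e₁₂
  generalize (show NonarchEdge ν₂ ν₃ from ε₂₃) = e₂₃
  generalize (show NonarchEdge ν₁ ν₂' from ε₁₂') = e₁₂'
  generalize (show NonarchEdge ν₂' ν₃ from ε₂'₃) = e₂'₃
  intro h₁ m₁₂ m₂₃ m₁₂' m₂'₃ hm₁₂ hm₂₃ hm₁₂' hm₂'₃
  cases e₁₂ <;> cases e₂₃ <;> cases e₁₂' <;> cases e₂'₃ <;>
    first
    | exact absurd h₁ (by decide)
    | (simp only [overIotaTS, overIotaCore, NatTrans.comp_app, eqToHom_app, Functor.whiskerRight_app, Functor.id_map,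
        heq_eqToHom_comp_iff] at hm₁₂ hm₂₃ hm₁₂' hm₂'₃
       obtain rfl := eq_of_heq hm₁₂
       obtain rfl := eq_of_heq hm₂₃
       obtain rfl := eq_of_heq hm₁₂'
       obtain rfl := eq_of_heq hm₂'₃
       first
       | rfl
       | (apply InducedCategory.hom_ext
          apply Prod.hom_ext
          · rfl
          · first
            | exact TFModel_iotaSquare_comm p (ι.obj X₀.down)
            | exact (TFModel_iotaSquare_comm p (ι.obj X₀.down)).symm))

end OverTS

variable (P ψ Vmod isArc)

/-- **The `TS`-valued `ι`-squares commute at every sub-model carrier**, for its `TS` datum `nonarchGenuineMonoAnSubTS`, at every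
nonarchimedean place (transported from over `ι := P.ι`; stated in the shape of abc-iut-f-101's `IotaSquaresCommute` with
`LogEdgeTS` / `T.iota`). [cite: MochizukiAbsTopIII2015, Definition 5.4 (iii) p.126] -/
theorem nonarchGenuineMonoAnSubTS_squaresCommute (v : Vmod) (hv : isArc v = false) ⦃ν₁ ν₂ ν₂' ν₃ : LogVertex (isArc v)⦄
    (h₁ : ν₁.isPostLog = false) (h₂ : ν₂.isPostLog = false) (h₂' : ν₂'.isPostLog = false) (h₃ : ν₃.isPostLog = false)
    (ε₁₂ : LogEdgeTS (isArc v) ν₁ ν₂) (ε₂₃ : LogEdgeTS (isArc v) ν₂ ν₃) (ε₁₂' : LogEdgeTS (isArc v) ν₁ ν₂')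
    (ε₂'₃ : LogEdgeTS (isArc v) ν₂' ν₃) (X₀ : (nonarchGenuineMonoAnSub p P ψ Vmod isArc).X)
    (m₁₂ : ((nonarchGenuineMonoAnSub p P ψ Vmod isArc).lam v ν₁).obj X₀ ⟶
      ((nonarchGenuineMonoAnSub p P ψ Vmod isArc).lam v ν₂).obj X₀)
    (m₂₃ : ((nonarchGenuineMonoAnSub p P ψ Vmod isArc).lam v ν₂).obj X₀ ⟶
      ((nonarchGenuineMonoAnSub p P ψ Vmod isArc).lam v ν₃).obj X₀)
    (m₁₂' : ((nonarchGenuineMonoAnSub p P ψ Vmod isArc).lam v ν₁).obj X₀ ⟶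
      ((nonarchGenuineMonoAnSub p P ψ Vmod isArc).lam v ν₂').obj X₀)
    (m₂'₃ : ((nonarchGenuineMonoAnSub p P ψ Vmod isArc).lam v ν₂').obj X₀ ⟶
      ((nonarchGenuineMonoAnSub p P ψ Vmod isArc).lam v ν₃).obj X₀)
    (hm₁₂ : HEq m₁₂ (((nonarchGenuineMonoAnSubTS p P ψ Vmod isArc).iota v ε₁₂).app X₀))
    (hm₂₃ : HEq m₂₃ (((nonarchGenuineMonoAnSubTS p P ψ Vmod isArc).iota v ε₂₃).app X₀))
    (hm₁₂' : HEq m₁₂' (((nonarchGenuineMonoAnSubTS p P ψ Vmod isArc).iota v ε₁₂').app X₀))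
    (hm₂'₃ : HEq m₂'₃ (((nonarchGenuineMonoAnSubTS p P ψ Vmod isArc).iota v ε₂'₃).app X₀)) :
    m₁₂ ≫ m₂₃ = m₁₂' ≫ m₂'₃ :=
  overIotaTS_squaresCommute p P.ι (isArc v) hv h₁ h₂ h₂' h₃ ε₁₂ ε₂₃ ε₁₂' ε₂'₃ X₀ m₁₂ m₂₃ m₁₂' m₂'₃ hm₁₂ hm₂₃ hm₁₂' hm₂'₃

/-- ★ **The `TS`-valued `ι`-squares commute at the genuine open-augmentation carrier** for `genuineOpenTS`, at every place.
[cite: MochizukiAbsTopIII2015, Definition 5.4 (iii) p.126] -/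
theorem genuineOpenTS_squaresCommute (v : Vmod) ⦃ν₁ ν₂ ν₂' ν₃ : LogVertex false⦄
    (h₁ : ν₁.isPostLog = false) (h₂ : ν₂.isPostLog = false) (h₂' : ν₂'.isPostLog = false) (h₃ : ν₃.isPostLog = false)
    (ε₁₂ : LogEdgeTS false ν₁ ν₂) (ε₂₃ : LogEdgeTS false ν₂ ν₃) (ε₁₂' : LogEdgeTS false ν₁ ν₂')
    (ε₂'₃ : LogEdgeTS false ν₂' ν₃) (X₀ : (genuineOpen p Vmod).X)
    (m₁₂ : ((genuineOpen p Vmod).lam v ν₁).obj X₀ ⟶ ((genuineOpen p Vmod).lam v ν₂).obj X₀)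
    (m₂₃ : ((genuineOpen p Vmod).lam v ν₂).obj X₀ ⟶ ((genuineOpen p Vmod).lam v ν₃).obj X₀)
    (m₁₂' : ((genuineOpen p Vmod).lam v ν₁).obj X₀ ⟶ ((genuineOpen p Vmod).lam v ν₂').obj X₀)
    (m₂'₃ : ((genuineOpen p Vmod).lam v ν₂').obj X₀ ⟶ ((genuineOpen p Vmod).lam v ν₃).obj X₀)
    (hm₁₂ : HEq m₁₂ (((genuineOpenTS p Vmod).iota v ε₁₂).app X₀))
    (hm₂₃ : HEq m₂₃ (((genuineOpenTS p Vmod).iota v ε₂₃).app X₀))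
    (hm₁₂' : HEq m₁₂' (((genuineOpenTS p Vmod).iota v ε₁₂').app X₀))
    (hm₂'₃ : HEq m₂'₃ (((genuineOpenTS p Vmod).iota v ε₂'₃).app X₀)) :
    m₁₂ ≫ m₂₃ = m₁₂' ≫ m₂'₃ :=
  nonarchGenuineMonoAnSubTS_squaresCommute p (TFModel.IsOpenAug (p := p)) MLFClosure.ψMonoPf Vmod (fun _ => false) v rfl h₁ h₂ h₂' h₃ ε₁₂ ε₂₃ ε₁₂' ε₂'₃ X₀ m₁₂ m₂₃ m₁₂' m₂'₃
    hm₁₂ hm₂₃ hm₁₂' hm₂'₃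

end LogFrobeniusSetting

end Literature.AnabelianGeometry.AbsoluteAnabelian
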